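import Literature.Computability.AlgebraicComplexity.GeneralisedGrenetMatrix
import Mathlib.LinearAlgebra.Matrix.Adjugate
import Mathlib.Data.Complex.Basic

/-! # Crux `UniqStep` (stmt-ValiantsHypothesis-17834), line `Sketch` (phase 2: the purified source twist) — stub `stub_minor`:
# the signed `(univ, ∅)`-minor of the purified source twist is honest, has determinant `(−1)^k · per_n`,
# and its `X(0,0)`-coefficient matrix is `E_{i₁ j₁} + E_{i₂ j₁} + E_{i₁ j₂}`

WHAT. Let `n = k + 3`, `R := MvPolynomial (Fin n × Fin n) ℂ`, and let `Kf : Matrix (Finset (Fin n))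
(Finset (Fin n)) R` be an abstract matrix indexed by the vertices of Grenet's hypercube such that
(i) every cell off the row `univ` and the column `∅` is `−X v` or a constant `C c`, the variable
`X (0, 0)` occurring (with coefficient `−1`) exactly at the cells `(∅, {0})`, `({1}, {0})`,
`(∅, {1, 2})`, and (ii) `adj(Kf)_{∅, univ} = (−1)^k · per_n`.  For a bijection
`e : Finset (Fin n) ≃ Fin (m + 1)` with `e ∅ = 0`, `e univ = Fin.last m` (`m + 1 = 2ⁿ`) let
`K := (−1)^(e univ + e ∅) • ((Kf.submatrix e.symm e.symm).submatrix (e univ).succAbove (e ∅).succAbove)`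
be the `ε`-signed `(univ, ∅)`-minor (the SAME indexing as `Grenet.repr`).  We prove:
(a) every cell of `K` is `X v` or `C c`; (b) `det K = (−1)^k · per_n`; (c) the coefficient matrix of
`X (0, 0)` in `K` is `E_{i₁ j₁} + E_{i₂ j₁} + E_{i₁ j₂}` with `i₁ ≠ i₂`, `j₁ ≠ j₂` (the rows labelled
`∅`, `{1}` and the columns labelled `{0}`, `{1, 2}`).
Proof: `e univ + e ∅ = m` is odd (`m + 1 = 2ⁿ`), so `ε = −1` and `K i j = −Kf (ρ i) (κ j)` with the
row / column labels `ρ i ≠ univ`, `κ j ≠ ∅` of `GeneralisedGrenetMatrix.lean`; (a) and (c) are then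
read off (i) (the labellings are injective and hit every admissible set), and (b) is the end of
`Grenet.isAffineDetRepr_repr`: `Matrix.adjugate_submatrix_equiv_self` and
`Matrix.adjugate_fin_succ_eq_det_submatrix` turn (ii) into `ε · det (minor) = (−1)^k · per_n`, while
`det K = ε^m · det (minor) = ε · det (minor)` because `m` is odd.

WHY. Stub V5 of the line: the composition `UniqStep_of` applies it to the purified source twist
`K_full = P · (1 − Grenet.adj ℂ n) · EQ` (cells from V3a/V3b, cofactor from V4) and obtains an honest
`(2ⁿ − 1) × (2ⁿ − 1)` matrix of determinant `± per_n` whose `X(0,0)`-coefficient has rank `2` (V6);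
no coefficient matrix of Grenet's matrix has rank `2` (V7), so the two optimal projections are
inequivalent, the antecedent `Uniq n` of the crux fails and `UniqStep` holds vacuously.

SOURCE. This session's construction (computations `compute/purify_*.py`); the signed minor and its
indexing are those of B. Grenet, *An upper bound for the permanent versus determinant problem* (2011),
Thm. 1 (`Grenet.repr`, `Grenet.isAffineDetRepr_repr` in `GrenetEquivariant.lean`); the `(3,7)` twist
is from J. Hüttenhain, C. Ikenmeyer, *Binary determinantal complexity*, Linear Algebra Appl. 504
(2016).  The lemmas here are elementary linear algebra over a commutative ring.
-/

-- D-0017 layout: Sub = Summit for this single-conjunct summit, so the namespace repeats a component.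
set_option linter.dupNamespace false

namespace Summit.ValiantsHypothesis.ValiantsHypothesis.Theorems.ProjectionStabilityUniqStep

open MvPolynomial
open scoped BigOperators Matrix
open Literature.Computability.AlgebraicComplexity
open Literature.Computability.AlgebraicComplexity.LRPencil

noncomputable section

/-! ### Helpers -/

/-- The size `m = 2^(k+3) − 1` of the minor is odd. [folklore] -/
theorem minor_size_odd {k m : ℕ} (hm : m + 1 = 2 ^ (k + 3)) : Odd m := by
  have h2 : Even (m + 1) := hm ▸ Nat.even_pow.mpr ⟨even_two, by omega⟩
  exact Nat.not_even_iff_odd.mp (Nat.even_add_one.mp h2)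

/-- Bookkeeping for the coefficient matrix: if a condition `P` holds exactly at the three positions
`(i₁, j₁)`, `(i₂, j₁)`, `(i₁, j₂)` (`i₁ ≠ i₂`, `j₁ ≠ j₂`), then `−[P] · (−1)` is the `(r, c)` entry of
`E_{i₁ j₁} + E_{i₂ j₁} + E_{i₁ j₂}`. [folklore] -/
theorem minor_neg_ite_eq_three_singles {ι R : Type*} [DecidableEq ι] [Ring R] {i₁ i₂ j₁ j₂ r c : ι}
    (hi : i₁ ≠ i₂) (hj : j₁ ≠ j₂) {P : Prop} {_ : Decidable P}
    (hP : P ↔ (r = i₁ ∧ c = j₁) ∨ (r = i₂ ∧ c = j₁) ∨ (r = i₁ ∧ c = j₂)) :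
    -(if P then (-1 : R) else 0) =
      (Matrix.single i₁ j₁ (1 : R) + Matrix.single i₂ j₁ 1 + Matrix.single i₁ j₂ 1 : Matrix ι ι R) r c := by
  rw [Matrix.add_apply, Matrix.add_apply, Matrix.single_apply, Matrix.single_apply,
    Matrix.single_apply]
  by_cases h : P
  · rw [if_pos h, neg_neg]
    rcases hP.mp h with ⟨hr, hc⟩ | ⟨hr, hc⟩ | ⟨hr, hc⟩
    · -- `r = i₁`, `c = j₁`
      rw [if_pos (And.intro hr.symm hc.symm),
        if_neg (fun h' : i₂ = r ∧ j₁ = c => hi (hr.symm.trans h'.1.symm)),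
        if_neg (fun h' : i₁ = r ∧ j₂ = c => hj (hc.symm.trans h'.2.symm)), add_zero, add_zero]
    · -- `r = i₂`, `c = j₁`
      rw [if_neg (fun h' : i₁ = r ∧ j₁ = c => hi (h'.1.trans hr)), if_pos (And.intro hr.symm hc.symm),
        if_neg (fun h' : i₁ = r ∧ j₂ = c => hi (h'.1.trans hr)), zero_add, add_zero]
    · -- `r = i₁`, `c = j₂`
      rw [if_neg (fun h' : i₁ = r ∧ j₁ = c => hj (h'.2.trans hc)),
        if_neg (fun h' : i₂ = r ∧ j₁ = c => hj (h'.2.trans hc)), if_pos (And.intro hr.symm hc.symm),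
        zero_add, zero_add]
  · rw [if_neg h, neg_zero]
    have h' : ¬((r = i₁ ∧ c = j₁) ∨ (r = i₂ ∧ c = j₁) ∨ (r = i₁ ∧ c = j₂)) := fun hh => h (hP.mpr hh)
    rw [if_neg (fun hh : i₁ = r ∧ j₁ = c => h' (Or.inl ⟨hh.1.symm, hh.2.symm⟩)),
      if_neg (fun hh : i₂ = r ∧ j₁ = c => h' (Or.inr (Or.inl ⟨hh.1.symm, hh.2.symm⟩))),
      if_neg (fun hh : i₁ = r ∧ j₂ = c => h' (Or.inr (Or.inr ⟨hh.1.symm, hh.2.symm⟩))),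
      add_zero, add_zero]

/-! ### The stub -/

/-- **STUB V5** of line `Sketch` (phase 2) of crux `UniqStep`: for an abstract matrix `Kf` on the
subsets of `Fin (k+3)` whose cells off the row `univ` / the column `∅` are `−X v` or constants, with
`X (0,0)` exactly at `(∅,{0})`, `({1},{0})`, `(∅,{1,2})` (coefficient `−1`) and with
`adj(Kf)_{∅,univ} = (−1)^k · per_{k+3}`, the `ε`-signed `(univ, ∅)`-minor (indexed like `Grenet.repr`,
`e ∅ = 0`, `e univ = last`) is honest, has determinant `(−1)^k · per_{k+3}`, and its
`X(0,0)`-coefficient matrix is `E_{i₁ j₁} + E_{i₂ j₁} + E_{i₁ j₂}` with `i₁ ≠ i₂`, `j₁ ≠ j₂`.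
[folklore] -/
theorem stub_minor :
    ∀ (k m : ℕ), m + 1 = 2 ^ (k + 3) →
    ∀ (e : Finset (Fin (k + 3)) ≃ Fin (m + 1)), e ∅ = 0 → e Finset.univ = Fin.last m →
    ∀ (Kf : Matrix (Finset (Fin (k + 3))) (Finset (Fin (k + 3))) (MvPolynomial (Fin (k + 3) × Fin (k + 3)) ℂ)),
    (∀ S T : Finset (Fin (k + 3)), S ≠ Finset.univ → T ≠ ∅ →
      ((∃ v, Kf S T = -X v) ∨ ∃ c, Kf S T = C c) ∧
      MvPolynomial.coeff (Finsupp.single ((0 : Fin (k + 3)), (0 : Fin (k + 3))) 1) (Kf S T) =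
        if (S = ∅ ∧ T = {0}) ∨ (S = {1} ∧ T = {0}) ∨ (S = ∅ ∧ T = {1, 2}) then -1 else 0) →
    Kf.adjugate ∅ Finset.univ = (-1) ^ k * perPoly (Fin (k + 3)) ℂ →
    (∀ i j, (∃ v, ((-1 : MvPolynomial (Fin (k + 3) × Fin (k + 3)) ℂ) ^ ((e Finset.univ : ℕ) + (e ∅ : ℕ)) •
        ((Kf.submatrix e.symm e.symm).submatrix (Fin.succAbove (e Finset.univ)) (Fin.succAbove (e ∅)))) i j = X v) ∨
      ∃ c, ((-1 : MvPolynomial (Fin (k + 3) × Fin (k + 3)) ℂ) ^ ((e Finset.univ : ℕ) + (e ∅ : ℕ)) •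
        ((Kf.submatrix e.symm e.symm).submatrix (Fin.succAbove (e Finset.univ)) (Fin.succAbove (e ∅)))) i j = C c) ∧
    ((-1 : MvPolynomial (Fin (k + 3) × Fin (k + 3)) ℂ) ^ ((e Finset.univ : ℕ) + (e ∅ : ℕ)) •
        ((Kf.submatrix e.symm e.symm).submatrix (Fin.succAbove (e Finset.univ)) (Fin.succAbove (e ∅)))).det =
      (-1) ^ k * perPoly (Fin (k + 3)) ℂ ∧
    ∃ (i₁ i₂ j₁ j₂ : Fin m), i₁ ≠ i₂ ∧ j₁ ≠ j₂ ∧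
      coeffMat ((-1 : MvPolynomial (Fin (k + 3) × Fin (k + 3)) ℂ) ^ ((e Finset.univ : ℕ) + (e ∅ : ℕ)) •
        ((Kf.submatrix e.symm e.symm).submatrix (Fin.succAbove (e Finset.univ)) (Fin.succAbove (e ∅)))) (0, 0) =
        Matrix.single i₁ j₁ 1 + Matrix.single i₂ j₁ 1 + Matrix.single i₁ j₂ 1 := by
  intro k m hm e he0 he1 Kf hcells hadj
  have hodd : Odd m := minor_size_odd hm
  -- the sign `ε = (−1)^(e univ + e ∅) = (−1)^m = −1`
  have hε : (-1 : MvPolynomial (Fin (k + 3) × Fin (k + 3)) ℂ) ^ ((e Finset.univ : ℕ) + (e ∅ : ℕ)) = -1 := by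
    rw [he1, he0, Fin.val_last, Fin.val_zero, add_zero]
    exact hodd.neg_one_pow
  -- the cells of the signed minor in terms of the row / column labels
  have hK : ∀ i j, ((-1 : MvPolynomial (Fin (k + 3) × Fin (k + 3)) ℂ) ^ ((e Finset.univ : ℕ) + (e ∅ : ℕ)) •
      ((Kf.submatrix e.symm e.symm).submatrix (Fin.succAbove (e Finset.univ)) (Fin.succAbove (e ∅)))) i j =
      -Kf (e.symm ((e Finset.univ).succAbove i)) (e.symm ((e ∅).succAbove j)) := by
    intro i j
    rw [Matrix.smul_apply, Matrix.submatrix_apply, Matrix.submatrix_apply, smul_eq_mul, hε, neg_one_mul]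
  refine ⟨fun i j => ?_, ?_, ?_⟩
  · -- (a) honesty: `−(−X v) = X v`, `−C c = C (−c)`
    obtain ⟨hcell, -⟩ := hcells _ _ (Grenet.rowSet_ne_univ e i) (Grenet.colSet_ne_empty e j)
    rw [hK]
    rcases hcell with ⟨v, hv⟩ | ⟨c, hc⟩
    · exact Or.inl ⟨v, by rw [hv, neg_neg]⟩
    · exact Or.inr ⟨-c, by rw [hc, map_neg]⟩
  · -- (b) the determinant, as at the end of `Grenet.isAffineDetRepr_repr`
    have hadj' : (Kf.submatrix e.symm e.symm).adjugate (e ∅) (e Finset.univ) =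
        (-1) ^ k * perPoly (Fin (k + 3)) ℂ := by
      rw [Matrix.adjugate_submatrix_equiv_self, Matrix.submatrix_apply, e.symm_apply_apply,
        e.symm_apply_apply]
      exact hadj
    rw [Matrix.adjugate_fin_succ_eq_det_submatrix] at hadj'
    rw [Matrix.det_smul, Fintype.card_fin, ← pow_mul, pow_mul', hodd.neg_one_pow]
    exact hadj'
  · -- (c) the coefficient matrix of `X (0, 0)`
    have h10 : (1 : Fin (k + 3)) ≠ 0 :=
      Fin.ne_of_val_ne (by rw [Fin.val_one, Fin.val_zero]; exact one_ne_zero)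
    have h1u : ({1} : Finset (Fin (k + 3))) ≠ Finset.univ := by
      intro h
      have h0 : (0 : Fin (k + 3)) ∈ ({1} : Finset (Fin (k + 3))) := by
        rw [h]; exact Finset.mem_univ 0
      exact h10 (Finset.mem_singleton.mp h0).symm
    obtain ⟨i₁, hi₁⟩ := Grenet.exists_rowSet_eq e (S := (∅ : Finset (Fin (k + 3))))
      (fun h => Finset.univ_nonempty.ne_empty h.symm)
    obtain ⟨i₂, hi₂⟩ := Grenet.exists_rowSet_eq e (S := ({1} : Finset (Fin (k + 3)))) h1u
    obtain ⟨j₁, hj₁⟩ := Grenet.exists_colSet_eq e (T := ({0} : Finset (Fin (k + 3))))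
      (Finset.singleton_ne_empty 0)
    obtain ⟨j₂, hj₂⟩ := Grenet.exists_colSet_eq e (T := ({1, 2} : Finset (Fin (k + 3))))
      (Finset.insert_ne_empty 1 {2})
    have hρ := Grenet.rowSet_injective e
    have hκ := Grenet.colSet_injective e
    have hi12 : i₁ ≠ i₂ := by
      rintro rfl
      exact Finset.singleton_ne_empty 1 (hi₂.symm.trans hi₁)
    have hj12 : j₁ ≠ j₂ := by
      rintro rfl
      have h1 : (1 : Fin (k + 3)) ∈ ({0} : Finset (Fin (k + 3))) := by
        rw [hj₁.symm.trans hj₂]; exact Finset.mem_insert_self 1 {2}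
      exact h10 (Finset.mem_singleton.mp h1)
    refine ⟨i₁, i₂, j₁, j₂, hi12, hj12, ?_⟩
    ext r c
    have hr1 : e.symm ((e Finset.univ).succAbove r) = ∅ ↔ r = i₁ := by
      rw [← hi₁]; exact hρ.eq_iff
    have hr2 : e.symm ((e Finset.univ).succAbove r) = {1} ↔ r = i₂ := by
      rw [← hi₂]; exact hρ.eq_iff
    have hc1 : e.symm ((e ∅).succAbove c) = {0} ↔ c = j₁ := by
      rw [← hj₁]; exact hκ.eq_iff
    have hc2 : e.symm ((e ∅).succAbove c) = {1, 2} ↔ c = j₂ := by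
      rw [← hj₂]; exact hκ.eq_iff
    rw [coeffMat_apply, hK, MvPolynomial.coeff_neg,
      (hcells _ _ (Grenet.rowSet_ne_univ e r) (Grenet.colSet_ne_empty e c)).2]
    refine minor_neg_ite_eq_three_singles hi12 hj12 ?_
    rw [hr1, hr2, hc1, hc2]

end

end Summit.ValiantsHypothesis.ValiantsHypothesis.Theorems.ProjectionStabilityUniqStep
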